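import Literature.NumberTheory.Transcendental.PhilipponCriterionRankOne
import Literature.NumberTheory.Transcendental.PhilipponCriterionLevel
import Mathlib.RingTheory.Ideal.MinimalPrime.Noetherian
import HarnessLib

/-!
# Philippon's criterion over Nesterenko's toolkit, XVII: Lemme 2.15 — proofs only

`Literature/NumberTheory/Transcendental/PhilipponCriterionEndgame.lean` — proofs only (no new
definitions, nothing asserted). Philippon's Lemme 2.15 (Publ. Math. IHÉS 64 (1986), §3, pp. 46–48:
"la suite `(𝔓_{N,1})` de l'assertion `(A_1)` est à valeurs dans un ensemble fini d'idéaux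
homogènes premiers"), in the following form. For a prime `𝔓` satisfying `(A_1)` at a large level
`N`, let `M` be the least level in `[N₀, N]` all of whose generators lie in `𝔓` (level `N`
qualifies, `mem_level_of_good`). Then:

* `Setup.level_min_props` — `M = N₀`, and `V(𝔓)` has an affine point `(1 : z)` with
  `max |z_i − θ_i| < e^{−R(N₀)}` (Philippon's two cases: "i) … montrons qu'alors `M = N₀`" via the
  descent bounds at level `M` and Prop. 4.11 (`r = 1`) at level `M − 1` with `S(M−1) ≥ C τ(M) δ(M)^k`;
  "2) … cette éventualité … contredisant la minimalité de `M`" via the level `M'` of the closest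
  point and Prop. 4.11 / Cor. 4.12 (`r = 1`));
* `Setup.mem_minimalPrimes_of_level` — consequently `𝔓` is a minimal prime of the FIXED ideal
  `𝔓₀ + (E N₀ j)_j` (a smaller prime through `(1 : z)` would have rank `≥ 2` and infinitely many
  zeros in the polydisc, against the finiteness hypothesis at level `N₀`), a finite set
  (replacing Philippon's count of primes of bounded degree and height).

## References

* [Philippon1986Criteres] P. Philippon, Publ. Math. IHÉS 64 (1986), §3, Lemme 2.15 (pp. 46–48).
* [NesterenkoPhilippon2001] LNM 1752 (2001), Ch. 3 Prop. 4.11, Cor. 4.12, Prop. 4.13 (pp. 40–41).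
-/

noncomputable section

open MvPolynomial Real
open Literature.NumberTheory.Transcendental.Nesterenko

attribute [local instance] MvPolynomial.gradedAlgebra

namespace Literature.NumberTheory.Transcendental

namespace PhilipponMain

namespace Setup

variable (𝒮 : Setup)

/-! ### Case 1: the minimal level is `N₀` -/

/-- **Case i) of Lemme 2.15** (Philippon 1986, pp. 46–47). Let `𝔓 ⊇ 𝔓₀` be a homogeneous prime of
rank `1` with `|𝔓(ω̄)| ≤ exp(−Λ size_N(𝔓))`, `Λ ≥ 2(1+11m²)`, and `M` a level with `N₀ < M ≤ N`,
all generators of level `M` in `𝔓` and an affine zero of `𝔓` in the open polydisc of level `M`.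
Then all generators of level `M − 1` lie in `𝔓` too (descent bounds at level `M`,
`S(M−1) ≥ C τ(M) δ(M)^k ≥ 2(1+11m²) size_M(𝔓)` and Prop. 4.11 with `r = 1`).
[cite: Philippon1986Criteres, §3 Lemme 2.15, case i) (pp. 46–47)] -/
theorem mem_pred_level (h44 : NesterenkoPhilippon2001_ch3_prop_4_4)
    (h47 : NesterenkoPhilippon2001_ch3_prop_4_7)
    (h411 : NesterenkoPhilippon2001_ch3_prop_4_11) (hr₀m : 𝒮.r₀ ≤ 𝒮.m) {𝔓 : Ideal (Rx 𝒮.m)}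
    (h𝔓 : 𝔓.IsPrime) (h𝔓hom : 𝔓.IsHomogeneous (homogeneousSubmodule (Fin (𝒮.m + 1)) ℚ))
    (h𝔓unm : IsUnmixedOfRank 𝔓 1) (h0 : 𝒮.𝔓₀ ≤ 𝔓) {M N : ℕ} (hM0 : 𝒮.N₀ < M) (hMN : M ≤ N)
    {Λ : ℝ} (hΛb : 2 * (1 + 11 * (𝒮.m : ℝ) ^ 2) ≤ Λ)
    (hsmall : iabs 𝔓 1 𝒮.ω ≤ exp (-(Λ * 𝒮.size N 𝔓 1)))
    (hCa : 2 * (1 + 11 * (𝒮.m : ℝ) ^ 2) * (𝒮.B 1 + 𝒮.D₀) ≤ 𝒮.C) (hb : ∀ j, 𝒮.E M j ∈ 𝔓)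
    {z : Fin 𝒮.m → ℂ} (hz : (Fin.cons 1 z : Fin (𝒮.m + 1) → ℂ) ∈ projZeros 𝔓)
    (hzθ : ∀ i, ‖z i - 𝒮.θ i‖ < exp (-𝒮.R M)) (j : Fin (𝒮.M (M - 1))) : 𝒮.E (M - 1) j ∈ 𝔓 := by
  obtain ⟨hdegM, hhM⟩ := 𝒮.bounds_of_descent h47 h411 hr₀m h𝔓 h𝔓hom h𝔓unm h0 hM0.le hb hz hzθ
  have hM1 : M - 1 + 1 = M := by omega
  have hM10 : 𝒮.N₀ ≤ M - 1 := by omega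
  set Y : ℝ := (1 + 11 * (𝒮.m : ℝ) ^ 2) * 𝒮.size M 𝔓 1 with hY
  have hsize := 𝒮.size_le_of_bounds (r := 1) M hdegM hhM
  have hτ := 𝒮.τ_pos M
  have hδ := 𝒮.δ_pos M
  have hδ1 := 𝒮.one_le_δ M
  have hm : (0 : ℝ) ≤ 1 + 11 * (𝒮.m : ℝ) ^ 2 := by positivity
  have hBD : 0 ≤ 𝒮.B 1 + 𝒮.D₀ := add_nonneg (𝒮.B_nonneg 1) (Nat.cast_nonneg _)
  have hs0 : 0 ≤ 𝒮.size M 𝔓 1 := 𝒮.size_nonneg M 𝔓 1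
  -- `2Y ≤ S(M−1)`
  have hS : 2 * Y ≤ 𝒮.S (M - 1) := by
    have h1 := 𝒮.S_ge_next (M - 1)
    rw [hM1] at h1
    have hpow : 𝒮.δ M ^ (𝒮.r₀ - 1) ≤ 𝒮.δ M ^ 𝒮.k :=
      pow_le_pow_right₀ hδ1 (by have := 𝒮.r₀_le; omega)
    have h2 : 𝒮.size M 𝔓 1 ≤ (𝒮.B 1 + 𝒮.D₀) * 𝒮.τ M * 𝒮.δ M ^ 𝒮.k :=
      hsize.trans (mul_le_mul_of_nonneg_left hpow (mul_nonneg hBD hτ.le))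
    have h3 : 2 * Y ≤ 2 * (1 + 11 * (𝒮.m : ℝ) ^ 2) * (𝒮.B 1 + 𝒮.D₀) * (𝒮.τ M * 𝒮.δ M ^ 𝒮.k) := by
      rw [hY]; nlinarith [mul_le_mul_of_nonneg_left h2 hm]
    have h4 : 2 * (1 + 11 * (𝒮.m : ℝ) ^ 2) * (𝒮.B 1 + 𝒮.D₀) * (𝒮.τ M * 𝒮.δ M ^ 𝒮.k) ≤
        𝒮.C * (𝒮.τ M * 𝒮.δ M ^ 𝒮.k) := mul_le_mul_of_nonneg_right hCa (by positivity)
    linarith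
  -- `2Y ≤ Λ size_N(𝔓)`
  have hA : 2 * Y ≤ Λ * 𝒮.size N 𝔓 1 := by
    have h1 : 𝒮.size M 𝔓 1 ≤ 𝒮.size N 𝔓 1 := 𝒮.size_mono hMN 𝔓 1
    have h2 : 0 ≤ 𝒮.size N 𝔓 1 := 𝒮.size_nonneg N 𝔓 1
    rw [hY]
    nlinarith [mul_le_mul_of_nonneg_right hΛb h2, mul_le_mul_of_nonneg_left h1 hm]
  -- `Y > 0` as `deg 𝔓 ≥ 1`
  have hY0 : 0 < Y := by
    have hdeg1 : 1 ≤ ideg 𝔓 1 :=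
      Literature.Barriers.Schanuel.one_le_ideg_of_isPrime h44 le_rfl 𝒮.one_le_m h𝔓 h𝔓hom h𝔓unm
    have h1 : (1 : ℝ) ≤ 𝒮.τ M * ideg 𝔓 1 :=
      one_le_mul_of_one_le_of_one_le (𝒮.one_le_τ M) (by exact_mod_cast hdeg1)
    have h2 := 𝒮.τ_mul_ideg_le_size M 𝔓 1
    rw [hY]; nlinarith [sq_nonneg (𝒮.m : ℝ)]
  have hX := 𝒮.bezout_exponent_le (Nat.sub_le M 1) hM10 j 𝔓 1
  refine 𝒮.mem_of_bezoutDelta_le h411 h𝔓 h𝔓hom h𝔓unm hM10 j hY0 hX ?_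
  refine (bezoutDelta_le_max 𝔓 1 (𝒮.E (M - 1) j) 𝒮.ω).trans (max_le ?_ ?_)
  · exact (𝒮.normAt_le (M - 1) hM10 j).trans (exp_le_exp.mpr (by linarith))
  · exact hsmall.trans (exp_le_exp.mpr (by linarith))

/-! ### Case 2: the level of the closest point -/

/-- **Case 2) of Lemme 2.15** (Philippon 1986, p. 47). Let `𝔓` be a homogeneous prime of rank `1`
with `|𝔓(ω̄)| ≤ exp(−Λ size_N(𝔓))`, `Λ ≥ 2(1+11m²)`, `Λ ≥ 10(1+12m²) ξ(N)`, and `M'` a level with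
`N₀ ≤ M' ≤ N` and `κ e^{−R(M'+1)} ≤ ρ_ω̄(𝔓)`. Then all generators of level `M'` lie in `𝔓`
(Prop. 4.11 with `r = 1` if `‖E‖_ω̄ ≤ ρ`, Cor. 4.12 with `r = 1` and `η = ⌈4ξ(M')⌉` otherwise).
[cite: Philippon1986Criteres, §3 Lemme 2.15, case 2) (p. 47)] -/
theorem mem_level_of_close (h44 : NesterenkoPhilippon2001_ch3_prop_4_4)
    (h411 : NesterenkoPhilippon2001_ch3_prop_4_11) (h412 : NesterenkoPhilippon2001_ch3_cor_4_12)
    {𝔓 : Ideal (Rx 𝒮.m)} (h𝔓 : 𝔓.IsPrime)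
    (h𝔓hom : 𝔓.IsHomogeneous (homogeneousSubmodule (Fin (𝒮.m + 1)) ℚ)) (h𝔓unm : IsUnmixedOfRank 𝔓 1)
    {M' N : ℕ} (hM'0 : 𝒮.N₀ ≤ M') (hM'N : M' ≤ N) {Λ : ℝ} (hΛb : 2 * (1 + 11 * (𝒮.m : ℝ) ^ 2) ≤ Λ)
    (hΛc : 10 * (1 + 12 * (𝒮.m : ℝ) ^ 2) * 𝒮.ξ N ≤ Λ)
    (hsmall : iabs 𝔓 1 𝒮.ω ≤ exp (-(Λ * 𝒮.size N 𝔓 1)))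
    (hρge : 𝒮.κ * exp (-𝒮.R (M' + 1)) ≤ rho 𝒮.ω 𝔓) (hCb : 2 * (𝒮.m : ℝ) ≤ 𝒮.C)
    (hCc : log (4 * 𝒮.Θ ^ 2) ≤ 𝒮.C) (j : Fin (𝒮.M M')) : 𝒮.E M' j ∈ 𝔓 := by
  set s : ℝ := 𝒮.size N 𝔓 1 with hs
  have hs1 : 1 ≤ s := by
    have hdeg1 : 1 ≤ ideg 𝔓 1 :=
      Literature.Barriers.Schanuel.one_le_ideg_of_isPrime h44 le_rfl 𝒮.one_le_m h𝔓 h𝔓hom h𝔓unm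
    have h1 : (1 : ℝ) ≤ 𝒮.τ N * ideg 𝔓 1 :=
      one_le_mul_of_one_le_of_one_le (𝒮.one_le_τ N) (by exact_mod_cast hdeg1)
    exact h1.trans (𝒮.τ_mul_ideg_le_size N 𝔓 1)
  have hs0 : 0 ≤ s := by linarith
  have hm : (0 : ℝ) < 1 + 11 * (𝒮.m : ℝ) ^ 2 := by positivity
  have hΛ0 : 0 < Λ := by linarith
  by_cases hle : normAt 𝒮.ω (𝒮.E M' j) ≤ rho 𝒮.ω 𝔓
  · -- `δ = |𝔓(ω̄)|`
    refine 𝒮.mem_of_bezoutDelta_le h411 h𝔓 h𝔓hom h𝔓unm hM'0 j (Y := (1 + 11 * (𝒮.m : ℝ) ^ 2) * s)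
      (by positivity) (𝒮.bezout_exponent_le hM'N hM'0 j 𝔓 1) ?_
    rw [bezoutDelta_of_le hle]
    refine hsmall.trans (exp_le_exp.mpr (neg_le_neg ?_))
    nlinarith [mul_le_mul_of_nonneg_right hΛb hs0]
  · -- `ρ < ‖E‖_ω̄`: Cor. 4.12 with `S = Λ s`, `η = ⌈4ξ(M')⌉`
    refine 𝒮.mem_of_rho_lt h412 h𝔓 h𝔓hom h𝔓unm hM'0 hM'N j (A := Λ * s) (by positivity) hsmall hρge
      hCb hCc ?_
    have hY := 𝒮.bezout_exponent_le' hM'N hM'0 j 𝔓 1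
    have hξ := (𝒮.ξ_pos N).le
    calc 5 * 𝒮.ξ N * (iheight 𝔓 1 * 𝒮.d M' j + height (𝒮.E M' j) * ideg 𝔓 1 +
          12 * (𝒮.m : ℝ) ^ 2 * 𝒮.d M' j * ideg 𝔓 1)
        ≤ 5 * 𝒮.ξ N * ((1 + 12 * (𝒮.m : ℝ) ^ 2) * s) := mul_le_mul_of_nonneg_left hY (by positivity)
      _ = (10 * (1 + 12 * (𝒮.m : ℝ) ^ 2) * 𝒮.ξ N) * s / 2 := by ring
      _ ≤ Λ * s / 2 := by
          apply div_le_div_of_nonneg_right _ (by norm_num)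
          exact mul_le_mul_of_nonneg_right hΛc hs0

/-! ### The minimal level is `N₀` -/

/-- **Lemme 2.15, core** (Philippon 1986, pp. 46–47). Let `𝔓` satisfy `(A_1)` at level `N ≥ N₀`
with quality `Λ = Λ_1(N)` (`Λ ≥ 2 + 8m³`, `Λ ≥ 2(1+11m²)`, `Λ ≥ 10(1+12m²)ξ(N)`), `C` large and
`R(N₀) + log(1/κ) < Λ τ(N)/2`. Then all generators of level `N₀` lie in `𝔓` and `V(𝔓)` has an
affine point `(1 : z)` with `max |z_i − θ_i| < e^{−R(N₀)}` (the least level `M ∈ [N₀, N]` all of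
whose generators lie in `𝔓` is `N₀`: case i) by `mem_pred_level`, case 2) is excluded by
`mem_level_of_close`). [cite: Philippon1986Criteres, §3 Lemme 2.15 (pp. 46–47)] -/
theorem level_min_props (h44 : NesterenkoPhilippon2001_ch3_prop_4_4)
    (h47 : NesterenkoPhilippon2001_ch3_prop_4_7) (h411 : NesterenkoPhilippon2001_ch3_prop_4_11)
    (h412 : NesterenkoPhilippon2001_ch3_cor_4_12) (h413 : NesterenkoPhilippon2001_ch3_prop_4_13)
    (hr₀m : 𝒮.r₀ ≤ 𝒮.m) {lam : ℝ} {N : ℕ} (hN : 𝒮.N₀ ≤ N) {𝔓 : Ideal (Rx 𝒮.m)}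
    (hgood : 𝒮.Good lam N 1 𝔓) (hΛa : 2 + 8 * (𝒮.m : ℝ) ^ 3 ≤ 𝒮.Λ lam 1 N)
    (hΛb : 2 * (1 + 11 * (𝒮.m : ℝ) ^ 2) ≤ 𝒮.Λ lam 1 N)
    (hΛc : 10 * (1 + 12 * (𝒮.m : ℝ) ^ 2) * 𝒮.ξ N ≤ 𝒮.Λ lam 1 N)
    (hCa : 2 * (1 + 11 * (𝒮.m : ℝ) ^ 2) * (𝒮.B 1 + 𝒮.D₀) ≤ 𝒮.C) (hCb : 2 * (𝒮.m : ℝ) ≤ 𝒮.C)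
    (hCc : log (4 * 𝒮.Θ ^ 2) ≤ 𝒮.C)
    (hNbig : 𝒮.R 𝒮.N₀ + log (1 / 𝒮.κ) < 𝒮.Λ lam 1 N * 𝒮.τ N / 2) :
    (∀ j, 𝒮.E 𝒮.N₀ j ∈ 𝔓) ∧ ∃ z : Fin 𝒮.m → ℂ, (Fin.cons 1 z : Fin (𝒮.m + 1) → ℂ) ∈ projZeros 𝔓 ∧
      ∀ i, ‖z i - 𝒮.θ i‖ < exp (-𝒮.R 𝒮.N₀) := by
  classical
  have hgood' := hgood
  obtain ⟨h𝔓, h𝔓hom, h0, r', hr'1, hr'r, hunm, hdeg, hh, hsmall⟩ := hgood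
  obtain rfl : r' = 1 := le_antisymm hr'r hr'1
  set Λ : ℝ := 𝒮.Λ lam 1 N with hΛdef
  have h𝔓c : ∀ g ∈ 𝔓, ∀ k : ℕ, homogeneousComponent k g ∈ 𝔓 :=
    fun g hg k => homogeneousComponent_mem_of_mem h𝔓hom hg k
  -- the closest point: `ρ ≤ exp(−Λ τ/2) < κ e^{−R(N₀)}`
  obtain ⟨hne, hρle⟩ := 𝒮.rho_le_of_small h44 h413 le_rfl 𝒮.one_le_m h𝔓 h𝔓hom hunm N
    (Λ := Λ) (by push_cast; linarith) hsmall
  have hρ0 : rho 𝒮.ω 𝔓 < 𝒮.κ * exp (-𝒮.R 𝒮.N₀) := by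
    refine lt_of_le_of_lt hρle ?_
    have hκ := 𝒮.κ_pos
    rw [← exp_log hκ, ← exp_add, exp_lt_exp]
    have : log (1 / 𝒮.κ) = -log 𝒮.κ := by rw [one_div, log_inv]
    rw [this] at hNbig
    push_cast at hNbig ⊢
    linarith
  -- the least level all of whose generators lie in `𝔓`
  have hex : ∃ L, 𝒮.N₀ ≤ L ∧ L ≤ N ∧ ∀ j, 𝒮.E L j ∈ 𝔓 :=
    ⟨N, hN, le_rfl, 𝒮.mem_level_of_good h44 h411 hN hgood' hΛb hCa⟩
  set M := Nat.find hex with hMdef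
  obtain ⟨hM0, hMN, hbM⟩ : 𝒮.N₀ ≤ M ∧ M ≤ N ∧ ∀ j, 𝒮.E M j ∈ 𝔓 := Nat.find_spec hex
  have hmin : ∀ L, L < M → ¬(𝒮.N₀ ≤ L ∧ L ≤ N ∧ ∀ j, 𝒮.E L j ∈ 𝔓) := fun L hL =>
    Nat.find_min hex hL
  by_cases hcase : rho 𝒮.ω 𝔓 < 𝒮.κ * exp (-𝒮.R M)
  · -- case i): an affine zero in the open polydisc of level `M`, and `M = N₀`
    obtain ⟨z, hz, hzθ⟩ := 𝒮.exists_affine_zero h𝔓c hne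
      (exp_le_one_iff.mpr (by linarith [𝒮.one_le_R M])) hcase
    have hMe : M = 𝒮.N₀ := by
      by_contra hne'
      have hlt : 𝒮.N₀ < M := lt_of_le_of_ne hM0 (Ne.symm hne')
      refine hmin (M - 1) (by omega) ⟨by omega, by omega, fun j => ?_⟩
      exact 𝒮.mem_pred_level h44 h47 h411 hr₀m h𝔓 h𝔓hom hunm h0 hlt hMN hΛb hsmall hCa hbM hz hzθ j
    rw [hMe] at hbM hzθ
    exact ⟨hbM, z, hz, hzθ⟩
  · -- case 2): the level `M'` of the closest point is `< M` and qualifies — excluded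
    exfalso
    push Not at hcase
    obtain ⟨M', hM'0, hM'N, hρM', hmax⟩ := 𝒮.exists_level hN hρ0
    have hM'M : M' < M := by
      by_contra hge
      push Not at hge
      have h1 : 𝒮.κ * exp (-𝒮.R M') ≤ 𝒮.κ * exp (-𝒮.R M) :=
        mul_le_mul_of_nonneg_left (exp_le_exp.mpr (neg_le_neg (𝒮.mono_R hge))) 𝒮.κ_pos.le
      linarith
    have hρge := hmax (lt_of_lt_of_le hM'M hMN)
    exact hmin M' hM'M ⟨hM'0, hM'N, 𝒮.mem_level_of_close h44 h411 h412 h𝔓 h𝔓hom hunm hM'0 hM'N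
      hΛb hΛc hsmall hρge hCb hCc⟩

/-! ### Finiteness: `𝔓` is a minimal prime of `𝔓₀ + (E N₀ j)_j` -/

/-- **The finite set** (replacing Philippon's count of primes of bounded degree and height, p. 48):
a homogeneous prime `𝔓 ⊇ 𝔓₀` of rank `1` containing all generators of level `N₀` and having an
affine zero `(1 : z)` with `max |z_i − θ_i| < e^{−R(N₀)}` is a minimal prime of the fixed ideal
`𝔓₀ + (E N₀ j)_j`: a strictly smaller prime over that ideal through `(1 : z)` has rank `≥ 2`, hence
infinitely many zeros `(1 : z')` in the polydisc (`infinite_projZeros_near`), all common zeros of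
the `E N₀ j` — against the finiteness hypothesis of Thm 2.11 at level `N₀`.
[cite: Philippon1986Criteres, §3 Lemme 2.15 (p. 48)] -/
theorem mem_minimalPrimes_of_level {𝔓 : Ideal (Rx 𝒮.m)} (h𝔓 : 𝔓.IsPrime) (h𝔓unm : IsUnmixedOfRank 𝔓 1)
    (h0 : 𝒮.𝔓₀ ≤ 𝔓) (hb : ∀ j, 𝒮.E 𝒮.N₀ j ∈ 𝔓) {z : Fin 𝒮.m → ℂ}
    (hz : (Fin.cons 1 z : Fin (𝒮.m + 1) → ℂ) ∈ projZeros 𝔓) (hzθ : ∀ i, ‖z i - 𝒮.θ i‖ < exp (-𝒮.R 𝒮.N₀)) :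
    𝔓 ∈ (𝒮.𝔓₀ ⊔ Ideal.span (Set.range (𝒮.E 𝒮.N₀))).minimalPrimes := by
  set 𝔄 : Ideal (Rx 𝒮.m) := 𝒮.𝔓₀ ⊔ Ideal.span (Set.range (𝒮.E 𝒮.N₀)) with h𝔄
  have h𝔄le : 𝔄 ≤ 𝔓 := sup_le h0 (Ideal.span_le.mpr (Set.range_subset_iff.mpr hb))
  have h𝔄hom : 𝔄.IsHomogeneous (homogeneousSubmodule (Fin (𝒮.m + 1)) ℚ) := by
    refine 𝒮.isHomogeneous_𝔓₀.sup (Ideal.homogeneous_span _ _ ?_)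
    rintro _ ⟨j, rfl⟩
    exact ⟨𝒮.d 𝒮.N₀ j, (mem_homogeneousSubmodule _ _).mpr (𝒮.isHomogeneous_E 𝒮.N₀ j)⟩
  haveI := h𝔓
  obtain ⟨𝔮, h𝔮min, h𝔮𝔓⟩ := Ideal.exists_minimalPrimes_le h𝔄le
  suffices h : 𝔮 = 𝔓 by rwa [← h]
  by_contra hne
  have hlt : 𝔮 < 𝔓 := lt_of_le_of_ne h𝔮𝔓 hne
  have h𝔮p : 𝔮.IsPrime := h𝔮min.1.1
  have h𝔄𝔮 : 𝔄 ≤ 𝔮 := h𝔮min.1.2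
  have h𝔮hom := isHomogeneous_of_mem_minimalPrimes h𝔄hom h𝔮min
  obtain ⟨r, hr⟩ := exists_nat_ringKrullDim_quotient h𝔮p
  have h𝔮unm : IsUnmixedOfRank 𝔮 r := isUnmixedOfRank_of_isPrime h𝔮p hr
  have hr2 : 2 ≤ r := rank_add_one_le_of_lt h𝔮p h𝔓 hlt h𝔮unm h𝔓unm
  have hz𝔮 : (Fin.cons 1 z : Fin (𝒮.m + 1) → ℂ) ∈ projZeros 𝔮 := projZeros_antitone h𝔮𝔓 hz
  obtain ⟨j, hj⟩ := exists_not_mem_of_finite_zeros hr2 h𝔮p h𝔮hom h𝔮unm 𝒮.θ (𝒮.E 𝒮.N₀)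
    (𝒮.finite_zeros 𝒮.N₀ le_rfl) hz𝔮 hzθ (exp_pos _)
  exact hj (h𝔄𝔮 (Ideal.mem_sup_right (Ideal.subset_span ⟨j, rfl⟩)))

end Setup

end PhilipponMain

end Literature.NumberTheory.Transcendental

end
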